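import Literature.NumberTheory.EllipticCurves.ZpExtensionEisensteinReadoutOrdinaryLocalKummerStrictMultiplicativeThreeProofs
import Summits.BirchSwinnertonDyer.BirchSwinnertonDyer.Theorems.UniversalToricDescentKummerStrictMultiplicative
import Summits.BirchSwinnertonDyer.BirchSwinnertonDyer.Theorems.UniversalToricDescentTwinTateLineAtThree
import HarnessLib

/-!
# The twin's Selmer readout at `v ∣ 3`, KS(v)-FREE: the local inclusion `localKerOver ≤ strictKer` at a
# multiplicative place above `3` is a THEOREM (helper, theorems only; no definition, no named fact, no `sorry`)

LEAD `bsd-wall-utd-p1` (g26), crux r205 stmt-BirchSwinnertonDyer-24737 `UniversalToricDescent.TwinAlgMuZeroAtThree`, line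
`beta-road` v10 cd44fe9d5c6b9a78, K2 stub `stub_howardOutputsOfFamily`, residue item (c) «readout/LINK at v ∣ 3» of STUB BRIEF
E2 v9 §12 — CLOSED here: the hypothesis `hKS` of the twin's readout `…ReadoutOrdinaryLocalKummerStrictMultiplicativeThreeProofs`
(p760847) is discharged by `…KummerStrictMultiplicative.localKerOver_le_strictKer_kernelOfReduction_of_hasMultiplicativeReductionAt`
(p763326: Greenberg LNM 1716 §2 p. 76 `Im κ ⊆ Im λ` for `C_v = E[p^∞] ∩ E₁(K̄_v)` at every multiplicative `v ∣ p`, `p` odd, via the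
tree's PROVED Tate uniformisation and ATAEC §V.4).

* `localKerOver_le_strictKer_kernelOfReduction_at_three` — KS(v) at a multiplicative `v ∣ 3` of `E/K` (any `W/ℚ`, any number field `K`,
  any `H ≤ Γ_K`);
* `twin_localKerOver_le_strictKer` — the same for the twin frame: `Rank1Residual.Mult W′ 3` ⟹ KS(w) at EVERY `w ∣ 3` of `K`;
* **`exists_quotient_cocycle_principal_of_eisensteinTowerReadout_mem_selmerInfty_of_hasMultiplicativeReductionAt_three`** — p760847's
  (hS′) with `hKS` removed: the input `hSv` of the twin's (B5-P) `…TwinReadoutLocalIndexThree.readoutLocalIndexThree_at_of_hasMultiplicativeReductionAt`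
  (p762007) is now unconditional at `v ∣ 3`.

BSD is proved for no curve by any of this; 24737 stays OPEN.
-/

set_option autoImplicit false
-- the summit and its single problem are both named `BirchSwinnertonDyer` (registry layout D-0017)
set_option linter.dupNamespace false

noncomputable section

open scoped Classical ContRepresentation

open NumberField IsDedekindDomain Field WeierstrassCurve
open Literature.NumberTheory.EllipticCurves Literature.NumberTheory.GaloisRepresentations
open Literature.NumberTheory.GaloisRepresentations.galoisCohomology
open Literature.NumberTheory.GaloisCohomology.Howard2004
open Literature.NumberTheory.EllipticCurves.GreenbergSelmer
open IwasawaAlgebra IwasawaAlgebra.EisensteinCoeff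
open Summit.BirchSwinnertonDyer.BirchSwinnertonDyer.Theorems.UniversalToricDescentKummerStrictMultiplicative
open Summit.BirchSwinnertonDyer.BirchSwinnertonDyer.Theorems.UniversalToricDescentTwinTateLineAtThree

namespace Summit.BirchSwinnertonDyer.BirchSwinnertonDyer.Theorems.UniversalToricDescentTwinReadoutKummerStrictAtThree

/-! ## §1 KS(v) at `v ∣ 3` -/

/-- **KS(v) at a place `v ∣ 3` of multiplicative reduction** (split or non-split) of `E = W ⊗ K`: for every `H ≤ Γ_K`,
`localKerOver 3 H K_v ≤ (kernelOfReductionLocalDatum 3 v).strictKer H` — Greenberg's `Im κ ⊆ Im λ` for `C_v = E[3^∞] ∩ E₁(K̄_v)`.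
[cite: GreenbergLNM1716, §2 pp. 75–76] [cite: SilvermanATAEC1994, §V.4, Thm. V.5.3] -/
theorem localKerOver_le_strictKer_kernelOfReduction_at_three {K : Type} [Field K] [NumberField K]
    (W : WeierstrassCurve ℚ) [W.IsElliptic] (v : HeightOneSpectrum (𝓞 K)) (hpv : ((3 : ℕ) : 𝓞 K) ∈ v.asIdeal)
    (hmult : (W.baseChange K).HasMultiplicativeReductionAt v) (H : Subgroup (absoluteGaloisGroup K)) :
    (W.baseChange K).localKerOver 3 H (v.adicCompletion K) ≤ ((W.baseChange K).kernelOfReductionLocalDatum 3 v).strictKer H := by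
  haveI : (W.baseChange K).IsElliptic := by rw [WeierstrassCurve.baseChange]; infer_instance
  exact localKerOver_le_strictKer_kernelOfReduction_of_hasMultiplicativeReductionAt (W.baseChange K) 3 (by norm_num) hpv hmult H

/-- **KS(w) for the twin at EVERY `w ∣ 3`**: for `W′/ℚ` multiplicative at `3` (`Rank1Residual.Mult W′ 3`, bucket B of crux 24737) and any
number field `K`, `E′_K = W′.baseChange K` is multiplicative at every `w ∋ 3` (`hasMultiplicativeReductionAt_baseChange_of_mult_three`,
p755134), hence `localKerOver 3 H K_w ≤ (kernelOfReductionLocalDatum 3 w).strictKer H` for every `H ≤ Γ_K`.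
[cite: GreenbergLNM1716, §2 pp. 75–76] [cite: SilvermanAEC2009, VII.5 Prop. 5.4 (b)] -/
theorem twin_localKerOver_le_strictKer (W' : WeierstrassCurve ℚ) [W'.IsElliptic] (hm : Rank1Residual.Mult W' 3)
    (K : Type) [Field K] [NumberField K] (w : HeightOneSpectrum (𝓞 K)) (hw : ((3 : ℕ) : 𝓞 K) ∈ w.asIdeal)
    (H : Subgroup (absoluteGaloisGroup K)) :
    (W'.baseChange K).localKerOver 3 H (w.adicCompletion K) ≤ ((W'.baseChange K).kernelOfReductionLocalDatum 3 w).strictKer H :=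
  localKerOver_le_strictKer_kernelOfReduction_at_three W' w hw
    (hasMultiplicativeReductionAt_baseChange_of_mult_three W' hm K w hw) H

/-! ## §2 The twin's (hS′) readout at `v ∣ 3`, `hKS`-free -/


open Literature.NumberTheory.EllipticCurves.ZpExtension (EisensteinLevel)

variable {K : Type} [Field K] [NumberField K] (W : WeierstrassCurve ℚ) [W.IsElliptic]
  (κ : ZpExtension K 3) {m : ℕ} (hm : 1 ≤ m)

variable (π : IwasawaAlgebra 3 ⧸ Ideal.span {(PowerSeries.X ^ m + PowerSeries.C ((3 : ℕ) : ℤ_[3]) : IwasawaAlgebra 3)})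
  (e : ℕ → ℕ)
  (hkill : letI := IwasawaAlgebra.isLocalRing_quotient_X_pow_add_C 3 hm
    ∀ k, ∀ r ∈ IsLocalRing.maximalIdeal
      (IwasawaAlgebra 3 ⧸ Ideal.span {(PowerSeries.X ^ m + PowerSeries.C ((3 : ℕ) : ℤ_[3]) : IwasawaAlgebra 3)}) ^ e k,
      ∀ x : EisensteinLevel 3 m (fun j ↦ geomTorsion (W.baseChange K) (((3 : ℕ) : ℤ) ^ j)) (k + 1), r • x = 0)
  (hker : letI := IwasawaAlgebra.isLocalRing_quotient_X_pow_add_C 3 hm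
    ∀ k, LinearMap.ker ((W.eisensteinTower (κ.unitTwist (-1)) hm).red k) =
      (IsLocalRing.maximalIdeal
        (IwasawaAlgebra 3 ⧸ Ideal.span {(PowerSeries.X ^ m + PowerSeries.C ((3 : ℕ) : ℤ_[3]) : IwasawaAlgebra 3)}) ^ e k) •
        (⊤ : Submodule (IwasawaAlgebra 3 ⧸ Ideal.span {(PowerSeries.X ^ m + PowerSeries.C ((3 : ℕ) : ℤ_[3]) : IwasawaAlgebra 3)})
          (EisensteinLevel 3 m (fun j ↦ geomTorsion (W.baseChange K) (((3 : ℕ) : ℤ) ^ j)) (k + 1 + 1))))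
  (hπ : letI := IwasawaAlgebra.isLocalRing_quotient_X_pow_add_C 3 hm
    π ∈ IsLocalRing.maximalIdeal
      (IwasawaAlgebra 3 ⧸ Ideal.span {(PowerSeries.X ^ m + PowerSeries.C ((3 : ℕ) : ℤ_[3]) : IwasawaAlgebra 3)}))
  (he : ∀ k, e k ≤ e (k + 1))
  (hπX : π = Ideal.Quotient.mk _ PowerSeries.X) (hek : ∀ k, e (k + 1) - e k = m)

set_option maxHeartbeats 1600000 in -- statement-size unification of the letter shapes (as the original)
include hπX hek in
/-- **hS′ at a place `v ∣ 3` of MULTIPLICATIVE reduction, UNCONDITIONALLY** — the twin's readout theorem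
`exists_quotient_cocycle_principal_of_eisensteinTowerReadout_mem_selmerInfty_of_localKerOver_le_of_hasMultiplicativeReductionAt_three`
(p760847) with its local-inclusion hypothesis `hKS` (KS(v): `localKerOver ≤ strictKer` for Greenberg's
`C_v = E[3^∞] ∩ E₁(K̄_v)`) DISCHARGED by `localKerOver_le_strictKer_kernelOfReduction_at_three` (Tate uniformisation +
ATAEC §V.4, split and non-split): there is `d` such that for every level `k` and class `c` whose readout lies in
`Sel_{3^∞}(E/K_∞)`, the image of `incLocIter … d (loc_v c)` in `H¹(K_v, T^{(k+d)}/Fil_v)` has a cocycle which is an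
honest coboundary on the elements of `Γ_{K_v}` restricting into `Gal(K̄/K_∞)`.
[cite: Howard2004HeegnerKolyvagin, Lemma 2.2.7 / Prop. 2.2.8 and proof of Thm. 2.2.10 (arXiv p. 17 L41–53)]
[cite: GreenbergLNM1716, §2 pp. 73–76] [cite: SilvermanATAEC1994, §V.4, Thm. V.5.3] -/
theorem exists_quotient_cocycle_principal_of_eisensteinTowerReadout_mem_selmerInfty_of_hasMultiplicativeReductionAt_three {γ : absoluteGaloisGroup K}
    (hγ : κ.IsTopGenerator γ) (v : HeightOneSpectrum (𝓞 K)) (hpv : ((3 : ℕ) : 𝓞 K) ∈ v.asIdeal)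
    (hmult : (W.baseChange K).HasMultiplicativeReductionAt v) :
    letI := IwasawaAlgebra.isLocalRing_quotient_X_pow_add_C 3 hm
    ∃ d : ℕ, ∀ (k : ℕ) (c : galoisCohomology
        ((κ.unitTwist (-1)).eisensteinTwist ((W.baseChange K).torsionGaloisModule (((3 : ℕ) : ℤ) ^ (k + 1))) hm (k + 1)) 1),
      W.eisensteinTowerReadout κ hm π e hkill hker hπ he hπX hek
          (AddCommGroup.DirectLimit.of _ _ k c :
            AdicTower.H1A (W.eisensteinTower (κ.unitTwist (-1)) hm) π e hkill hker hπ he) ∈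
        (W.baseChange K).selmerInfty κ →
      ∃ φq : contOneCocycles ((GaloisRep.toLocal v ((κ.unitTwist (-1)).eisensteinTwist
          ((W.baseChange K).torsionGaloisModule (((3 : ℕ) : ℤ) ^ (k + d + 1))) hm (k + d + 1))).quotient
          (((W.baseChange K).ordinaryFiltrationAt v (fun i ↦ (W.baseChange K).torsionGaloisModuleReduce 3 i)
            (fun _ _ ↦ rfl)).twistedFil (k + d + 1))
          (((W.baseChange K).ordinaryFiltrationAt v (fun i ↦ (W.baseChange K).torsionGaloisModuleReduce 3 i)
            (fun _ _ ↦ rfl)).twistedFil_le_comap (κ := κ.unitTwist (-1)) hm (k + d + 1))).toTopRep,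
        oneCocycleClass _ φq =
          DiscreteGaloisModule.quotientMap (GaloisRep.toLocal v ((κ.unitTwist (-1)).eisensteinTwist
              ((W.baseChange K).torsionGaloisModule (((3 : ℕ) : ℤ) ^ (k + d + 1))) hm (k + d + 1)))
            (((W.baseChange K).ordinaryFiltrationAt v (fun i ↦ (W.baseChange K).torsionGaloisModuleReduce 3 i)
              (fun _ _ ↦ rfl)).twistedFil (k + d + 1))
            (((W.baseChange K).ordinaryFiltrationAt v (fun i ↦ (W.baseChange K).torsionGaloisModuleReduce 3 i)
              (fun _ _ ↦ rfl)).twistedFil_le_comap (κ := κ.unitTwist (-1)) hm (k + d + 1)) 1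
            (AdicTower.incLocIter (W.eisensteinTower (κ.unitTwist (-1)) hm) π e hkill hker hπ he k (Sum.inr v) d
              (galoisCohomology.localization
                ((κ.unitTwist (-1)).eisensteinTwist ((W.baseChange K).torsionGaloisModule (((3 : ℕ) : ℤ) ^ (k + 1))) hm (k + 1))
                (Sum.inr v) 1 c)) ∧
        ∃ q₀ : Twisted 3 m (k + d + 1) (geomTorsion (W.baseChange K) (((3 : ℕ) : ℤ) ^ (k + d + 1))) ⧸
            ((W.baseChange K).ordinaryFiltrationAt v (fun i ↦ (W.baseChange K).torsionGaloisModuleReduce 3 i)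
              (fun _ _ ↦ rfl)).twistedFil (k + d + 1),
          ∀ σ : absoluteGaloisGroup (v.adicCompletion K), absGaloisRestrict K (v.adicCompletion K) σ ∈ κ.kerSubgroup →
            φq.1 σ = (GaloisRep.toLocal v ((κ.unitTwist (-1)).eisensteinTwist
                ((W.baseChange K).torsionGaloisModule (((3 : ℕ) : ℤ) ^ (k + d + 1))) hm (k + d + 1))).quotient
                (((W.baseChange K).ordinaryFiltrationAt v (fun i ↦ (W.baseChange K).torsionGaloisModuleReduce 3 i)
                  (fun _ _ ↦ rfl)).twistedFil (k + d + 1))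
                (((W.baseChange K).ordinaryFiltrationAt v (fun i ↦ (W.baseChange K).torsionGaloisModuleReduce 3 i)
                  (fun _ _ ↦ rfl)).twistedFil_le_comap (κ := κ.unitTwist (-1)) hm (k + d + 1)) σ q₀ - q₀ := by
  exact W.exists_quotient_cocycle_principal_of_eisensteinTowerReadout_mem_selmerInfty_of_localKerOver_le_of_hasMultiplicativeReductionAt_three
    κ hm π e hkill hker hπ he hπX hek hγ v hpv hmult
    (localKerOver_le_strictKer_kernelOfReduction_at_three W v hpv hmult κ.kerSubgroup)

end Summit.BirchSwinnertonDyer.BirchSwinnertonDyer.Theorems.UniversalToricDescentTwinReadoutKummerStrictAtThree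

end
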